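import Summits.ResolutionOfSingularities.ResolutionOfSingularities.Theorems.DeepCrossCutKernels
import HarnessLib

/-!
# DeepCrossCutKernels2 — decomp-res node «DeepCrossCut» §Y.0 RING KERNELS (lens-2 g21 rev7), file 2/3 of `DeepCrossCutKernels`

Content VERBATIM from §Y.0 (ring level) and the inhabitant kernels of the decomp-res lens-2 g21 node
`HOME/decomp-res-lens-2/g21/DeepCrossCut.lean`
(rev7, pin 607dfe85, 5 760 l; HOME = run/shared/lean/pub/decomp-res); CRITIC-LEDGER row 168 (RIDERS: the
scheme-level §Y — engines `DeepCrossExit` /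
`NodeExit`, the deep leaf, `Deep.closes`, the re-location of `Cross.CrossSpecialRung` — is HELD until the critic's
(d′) window closes and is NOT in
these files); landing orders INBOX :712 (the §Y.0 decl list) + :770 (rev7 additions `deepNewt` …
`deepCrossNewtShape_insepVV7`).  The node's
l. 132–4440 restate the earlier lens-2 nodes VERBATIM and are DELETED here (landed as `PinchCut…` / `JetCut…` /
`PurityCut…` / `SplitCut…` /
`CylinderCut…` / `SpreadCut…` / `CrossCut…`; never two copies); these ring kernels are CommRing-generic and import
only the top of the
landed lens-2 column (`SplitCutKernels2`) for the opened namespaces; the FOUR comparison lemmas with g20's `crossWt`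
/ `CrossShape`
(`deepWt_le_crossWt`, `crossWt_le_deepWt_self`, `deepCrossShape_self_iff`, `crossShape_of_deepCrossNewtShape_self`)
wait for `CrossCutLaw2` to land and
follow VERBATIM in `DeepCrossCutKernelsCross.lean` (dependency split, critic INBOX :799 «LAND NOW»).  Namespace
`…Theorems.DeepCrossCut` (the lens's `Theses.DeepCrossCut` is gate-reserved);
sections `DeepRing` ⊃ `NodeKernel`, `DeepKernel` and `InhabitantKernel`, the `variable` line, `open MvPolynomial`
and every declaration exactly as
in the lens; file split only (tree files ≤ 400 lines).  RING KERNELS ONLY: PROVED identities and monomial-ideal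
bookkeeping (0 sorry) + the two
named inhabitants INSEP-vv7 = `z² + u₁⁵ + v²u₂⁷ /𝔽₂` (chart by chart) and the nodal `N`; no scheme-level statement,
no engine, no aside, no
route edit.  All `--supports stmt-ResolutionOfSingularities-29273` (`MaxContactCut.RungOne`, the lens-2 column
root); nothing closes it.

§Y.0 ring level: THE NODE WEIGHT `nodeWt` and the node / pivot letters `NodeShape` / `PivotShape` with their chart
identities; THE DEEP-CROSS
WEIGHT `deepWt`, `DeepCrossShape`, the rev7 NEWTON MEMBER IDEAL `deepNewt` with `DeepCrossNewtShape` (⇒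
`DeepCrossShape`), the steep-pair weight `pairWt` / `SteepPairShape`,
the tower / chart identities `deep_towerOne` / `deep_vChart`; the INHABITANT KERNELS: `insepVV7_chart0…9`,
`insepVV7` / `deepFrame` /
`represent_INSEPvv7` / `deepCrossShape_insepVV7` / `deepCrossNewtShape_insepVV7` / `insepVV7_mem_sq_steep` /
`insepVV7_mem_sq_flat`, and the
nodal `nodalN` / `represent_nodalN` / `nodeShape_nodalN`.  PROVED kernels, VERBATIM (continued `…2` where the
400-line cap cuts).

Part 2/3 carries: `deep_terms_mem_deepWt`, `deepNewt`, `monomial_mem_deepNewt`, `deepNewt_le_deepWt`,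
`deepWt_le_deepNewt`, `deep_terms_mem_deepNewt`, `subflank_mem_deepWt`, `DeepCrossNewtShape`,
`deepCrossNewtShape_to_deepCrossShape`, `deepTail_le_deepNewt`, `pairWt`, `monomial_mem_pairWt`, `SteepPairShape`,
`deep_towerOne`, `deep_vChart`, `insepVV7_chart0`, `insepVV7_chart1`, `insepVV7_chart2`, `insepVV7_chart3`,
`insepVV7_chart4`, `insepVV7_chart5`, `insepVV7_chart6`.

(Sources: Hironaka1967; CossartJannsenSaito2020 Ch. 2; CossartPiltant2008 Prop. 4.2; CossartPiltant2019 Rem. 3.2;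
Hauser2010Kangaroo; Moh1987.)
-/

open CategoryTheory AlgebraicGeometry TopologicalSpace IsLocalRing
open Literature.AlgebraicGeometry.Resolution
open Summit.ResolutionOfSingularities.ResolutionOfSingularities.Theorems
open Summit.ResolutionOfSingularities.ResolutionOfSingularities.Theorems.WeakOrderReduction
open Summit.ResolutionOfSingularities.ResolutionOfSingularities.Theorems.DeltaFaceCutClasses
open Summit.ResolutionOfSingularities.ResolutionOfSingularities.Theorems.RelativeDeltaCut
open Summit.ResolutionOfSingularities.ResolutionOfSingularities.Theorems.CurveLeafExit
open Summit.ResolutionOfSingularities.ResolutionOfSingularities.Theorems.PinchCut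
open Summit.ResolutionOfSingularities.ResolutionOfSingularities.Theorems.JetCut
open Summit.ResolutionOfSingularities.ResolutionOfSingularities.Theorems.PurityCut
open Summit.ResolutionOfSingularities.ResolutionOfSingularities.Theorems.SplitCut
open MvPolynomial

namespace Summit.ResolutionOfSingularities.ResolutionOfSingularities.Theorems.DeepCrossCut

section DeepRing

variable {R : Type} [CommRing R]

/-- The three displayed terms of a deep-cross member carry the three weights (`d ≥ m`): `z²` (`2m, 2q, 2md`), `u₁^m`
(`2m, m, 2md`),
`v²u₂^d` (`2d ≥ 2m, 2q, 2md`).  KERNEL (PROVED; letter bookkeeping). [folklore] -/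
theorem deep_terms_mem_deepWt (c : Fin 4 → R) (e₁ e₂ : R) (q d : ℕ) (hd : 2 * q + 1 ≤ d) :
    c 0 ^ 2 + e₁ * c 1 ^ (2 * q + 1) + e₂ * c 3 ^ 2 * c 2 ^ d ∈
      deepWt c q d (2 * (2 * q + 1)) (2 * q) (2 * (2 * q + 1) * d) := by
  refine Ideal.add_mem _ (Ideal.add_mem _ ?_ ?_) ?_
  · have h := monomial_mem_deepWt c q d (2 * (2 * q + 1)) (2 * q) (2 * (2 * q + 1) * d) 2 0 0 0
      (by ring_nf; omega) (by omega) (by ring_nf; omega)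
    simpa using h
  · have h := monomial_mem_deepWt c q d (2 * (2 * q + 1)) (2 * q) (2 * (2 * q + 1) * d) 0 (2 * q + 1) 0 0
      (by ring_nf; omega) (by omega) (by ring_nf; omega)
    have h' : e₁ * c 1 ^ (2 * q + 1) = e₁ * (c 0 ^ 0 * c 1 ^ (2 * q + 1) * c 2 ^ 0 * c 3 ^ 0) := by ring
    rw [h']
    exact Ideal.mul_mem_left _ _ h
  · have h3 : 2 * (2 * q + 1) * d ≤ (2 * q + 1) * d * 0 + 2 * d * 0 + 2 * (2 * q + 1) * d := by ring_nf; omega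
    have h1 : 2 * (2 * q + 1) ≤ (2 * q + 1) * 0 + 2 * (0 + d) := by omega
    have h := monomial_mem_deepWt c q d (2 * (2 * q + 1)) (2 * q) (2 * (2 * q + 1) * d) 0 0 d 2 h1 (by omega) h3
    have h' : e₂ * c 3 ^ 2 * c 2 ^ d = e₂ * (c 0 ^ 0 * c 1 ^ 0 * c 2 ^ d * c 3 ^ 2) := by ring
    rw [h']
    exact Ideal.mul_mem_left _ _ h

/-- **THE NEWTON MEMBER IDEAL** [g21 rev7] (`deepNewt c q d`, `m = 2q+1 ≤ d`): the monomials `z^i·u₁^a·u₂^b·v^e` ON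
OR ABOVE THE NEWTON
POLYHEDRON `conv{z², u₁^m, v²u₂^d} + ℝ⁴₊` of the deep binomial, typed by its two non-coordinate FACET weights — the
binomial-face weight
`W₃ = md·i + 2d·a + 2m·b ≥ 2md` and the FLANK-FACE weight `W₂′ := m·i + 2a + m·e ≥ 2m` (for which `z², u₁^m, v²` are simultaneously
initial) — together with the (implied, `d ≥ m`) steep and flank weights `W₁ ≥ 2m`, `W₂ ≥ 2q` of `deepWt`.  g20's
flank weight `W₂ = q·i + a + q·e`
is the valuation of the LAST flank divisor `(1,0,q)`, under which `u₁^m` is NOT initial: the triply-weighted member bound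
`deepWt c q d (2m) (2q) (2md)` of rev ≤ 6 (g20's `crossWt` at `d = m`) admits the sub-flank monomials
`u₁^{m−k}u₂^{⌈dk/m⌉}` (`k ≤ q`),
`u₁^{q−j}u₂^{⌈d(q+1+j)/m⌉}v` which lie UNDER the flank face (`subflank_mem_deepWt`; Probe P23–P25).  By concavity of
`V ↦ min(V(z²), V(u₁^m), V(v²u₂^d))` a member of `deepNewt` dominates the binomial under EVERY monomial valuation of
the frame — what the
TAIL LEMMA (T5) STEP 3 uses on every centre of the bed package.  DEFINITION (NEW object: the RE-TYPED member bound
of the deep-cross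
letter, critic row 168 (d′)(α)). (Sources: Hironaka1967; CossartJannsenSaito2020 Ch. 8; CossartPiltant2019 Prop. 2.6.) -/
def deepNewt (c : Fin 4 → R) (q d : ℕ) : Ideal R :=
  Ideal.span {x | ∃ i a b e : ℕ, 2 * (2 * q + 1) ≤ (2 * q + 1) * i + 2 * (a + b) ∧ 2 * q ≤ q * i + a + q * e ∧
    2 * (2 * q + 1) * d ≤ (2 * q + 1) * d * i + 2 * d * a + 2 * (2 * q + 1) * b ∧
    2 * (2 * q + 1) ≤ (2 * q + 1) * i + 2 * a + (2 * q + 1) * e ∧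
    x = c 0 ^ i * c 1 ^ a * c 2 ^ b * c 3 ^ e}

/-- Monomials carrying the four weights lie in the Newton member ideal.  KERNEL (PROVED). [folklore] -/
theorem monomial_mem_deepNewt (c : Fin 4 → R) (q d i a b e : ℕ) (h₁ : 2 * (2 * q + 1) ≤ (2 * q + 1) * i + 2 * (a + b))
    (h₂ : 2 * q ≤ q * i + a + q * e) (h₃ : 2 * (2 * q + 1) * d ≤ (2 * q + 1) * d * i + 2 * d * a + 2 * (2 * q + 1) * b)
    (h₄ : 2 * (2 * q + 1) ≤ (2 * q + 1) * i + 2 * a + (2 * q + 1) * e) :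
    c 0 ^ i * c 1 ^ a * c 2 ^ b * c 3 ^ e ∈ deepNewt c q d :=
  Ideal.subset_span ⟨i, a, b, e, h₁, h₂, h₃, h₄, rfl⟩

/-- **THE RE-TYPED CLASS IS A SUBCLASS**: the Newton member ideal lies in the triply-weighted member ideal of rev ≤
6 (forget the flank-face
weight).  KERNEL (PROVED). [folklore] -/
theorem deepNewt_le_deepWt (c : Fin 4 → R) (q d : ℕ) :
    deepNewt c q d ≤ deepWt c q d (2 * (2 * q + 1)) (2 * q) (2 * (2 * q + 1) * d) := by
  apply Ideal.span_mono
  rintro x ⟨i, a, b, e, hw₁, hw₂, hw₃, -, rfl⟩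
  exact ⟨i, a, b, e, hw₁, hw₂, hw₃, rfl⟩

/-- **TAILS LIE IN THE NEWTON MEMBER IDEAL**: a deep ideal with STRICT flank threshold `λ₂ ≥ 2q+1` (and `λ₁ ≥ 2m`,
`λ₃ ≥ 2md`) lies in
`deepNewt` — `W₂′ = 2·W₂ + (i + e)`.  In particular the tail ideal `deepWt c q d (2m+1) (2q+1) (2md+1)` of the
letter does (with `deepWt_anti`).
KERNEL (PROVED). [folklore] -/
theorem deepWt_le_deepNewt (c : Fin 4 → R) (q d l₁ l₂ l₃ : ℕ) (h₁ : 2 * (2 * q + 1) ≤ l₁) (h₂ : 2 * q + 1 ≤ l₂)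
    (h₃ : 2 * (2 * q + 1) * d ≤ l₃) : deepWt c q d l₁ l₂ l₃ ≤ deepNewt c q d := by
  apply Ideal.span_mono
  rintro x ⟨i, a, b, e, hw₁, hw₂, hw₃, rfl⟩
  refine ⟨i, a, b, e, le_trans h₁ hw₁, le_trans (Nat.le_succ _) (le_trans h₂ hw₂), le_trans h₃ hw₃, ?_, rfl⟩
  have hw₂' : 2 * q + 1 ≤ q * i + a + q * e := le_trans h₂ hw₂
  have key : (2 * q + 1) * i + 2 * a + (2 * q + 1) * e = 2 * (q * i + a + q * e) + (i + e) := by ring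
  rw [key]
  omega

/-- The three displayed terms of a deep-cross member lie in the Newton member ideal (`d ≥ m`): `z²`, `u₁^m`,
`v²u₂^d` are the vertices of
the Newton polyhedron (`W₂′ = 2m` for all three).  KERNEL (PROVED; letter bookkeeping). [folklore] -/
theorem deep_terms_mem_deepNewt (c : Fin 4 → R) (e₁ e₂ : R) (q d : ℕ) (hd : 2 * q + 1 ≤ d) :
    c 0 ^ 2 + e₁ * c 1 ^ (2 * q + 1) + e₂ * c 3 ^ 2 * c 2 ^ d ∈ deepNewt c q d := by
  refine Ideal.add_mem _ (Ideal.add_mem _ ?_ ?_) ?_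
  · have h := monomial_mem_deepNewt c q d 2 0 0 0
      (by ring_nf; omega) (by omega) (by ring_nf; omega) (by ring_nf; omega)
    simpa using h
  · have h := monomial_mem_deepNewt c q d 0 (2 * q + 1) 0 0
      (by ring_nf; omega) (by omega) (by ring_nf; omega) (by ring_nf; omega)
    have h' : e₁ * c 1 ^ (2 * q + 1) = e₁ * (c 0 ^ 0 * c 1 ^ (2 * q + 1) * c 2 ^ 0 * c 3 ^ 0) := by ring
    rw [h']
    exact Ideal.mul_mem_left _ _ h
  · have h3 : 2 * (2 * q + 1) * d ≤ (2 * q + 1) * d * 0 + 2 * d * 0 + 2 * (2 * q + 1) * d := by ring_nf; omega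
    have h1 : 2 * (2 * q + 1) ≤ (2 * q + 1) * 0 + 2 * (0 + d) := by omega
    have h4 : 2 * (2 * q + 1) ≤ (2 * q + 1) * 0 + 2 * 0 + (2 * q + 1) * 2 := by ring_nf; omega
    have h := monomial_mem_deepNewt c q d 0 0 d 2 h1 (by omega) h3 h4
    have h' : e₂ * c 3 ^ 2 * c 2 ^ d = e₂ * (c 0 ^ 0 * c 1 ^ 0 * c 2 ^ d * c 3 ^ 2) := by ring
    rw [h']
    exact Ideal.mul_mem_left _ _ h

/-- **THE SEPARATING SUB-FLANK MONOMIAL** `u₁^{2q}·u₂^r` (`m·r ≥ d`, `r ≥ 1`; `r = ⌈d/m⌉`) satisfies the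
triply-weighted member bound of
rev ≤ 6 — it lies UNDER the flank face (`W₂′ = 2m − 2 < 2m`), so NOT in the Newton polyhedron: the witness that the
re-typed letter is
STRICTLY stronger (non-membership in `deepNewt` is a statement about a free frame and is certified by Probe P23,
MUST-FAIL).  KERNEL
(PROVED). [folklore] -/
theorem subflank_mem_deepWt (c : Fin 4 → R) (q d r : ℕ) (hr : d ≤ (2 * q + 1) * r) (hr₁ : 1 ≤ r) :
    c 1 ^ (2 * q) * c 2 ^ r ∈ deepWt c q d (2 * (2 * q + 1)) (2 * q) (2 * (2 * q + 1) * d) := by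
  have h3 : 2 * (2 * q + 1) * d ≤ (2 * q + 1) * d * 0 + 2 * d * (2 * q) + 2 * (2 * q + 1) * r := by
    have e1 : 2 * (2 * q + 1) * d = 2 * d * (2 * q) + 2 * d := by ring
    have e2 : (2 * q + 1) * d * 0 + 2 * d * (2 * q) + 2 * (2 * q + 1) * r = 2 * d * (2 * q) + 2 * ((2 * q + 1) * r) := by ring
    rw [e1, e2]
    omega
  have h := monomial_mem_deepWt c q d (2 * (2 * q + 1)) (2 * q) (2 * (2 * q + 1) * d) 0 (2 * q) r 0 (by omega) (by omega) h3
  simpa using h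

/-- **DEEP-CROSS SHAPE, NEWTON-TYPED** [g21 rev7] (`DeepCrossNewtShape J c q d`) — THE LETTER of the deep-cross
class at a tangle point:
a member `f = z² + ε₁·u₁^m + ε₂·v²·u₂^d + g ∈ J`, `m = 2q+1 ≤ d`, `ε₁, ε₂` UNITS, tail strictly above all three faces
(`g ∈ deepWt c q d (2m+1) (2q+1) (2md+1) ⊆ deepNewt`, `deepWt_le_deepNewt`), and the WHOLE IDEAL IN THE NEWTON MEMBER IDEAL
(`J ⊆ deepNewt c q d`).  Compared with `DeepCrossShape` (rev ≤ 6; g20's `CrossShape` at `d = m`) only the member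
bound changed, and the
class SHRANK (`deepCrossNewtShape_to_deepCrossShape`); tangle points satisfying only the weaker bound belong to the
located residual.  With
this letter the TAIL LEMMA (T5) transports EVERY member of `J` along the bed package by convexity (§Y.1 (X**) (T5)
STEP 3).  DEFINITION
(NEW class predicate, ring level; the re-typing asked for by critic row 168 (d′)(α)). (Sources: Hironaka1967;
CossartJannsenSaito2020 Ch. 8;
CossartPiltant2019 Def. 3.5.) -/
def DeepCrossNewtShape (J : Ideal R) (c : Fin 4 → R) (q d : ℕ) : Prop :=
  ∃ e₁ e₂ g : R, IsUnit e₁ ∧ IsUnit e₂ ∧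
    g ∈ deepWt c q d (2 * (2 * q + 1) + 1) (2 * q + 1) (2 * (2 * q + 1) * d + 1) ∧
    c 0 ^ 2 + e₁ * c 1 ^ (2 * q + 1) + e₂ * c 3 ^ 2 * c 2 ^ d + g ∈ J ∧
    J ≤ deepNewt c q d

/-- The Newton-typed letter implies the triply-weighted letter of rev ≤ 6 (the class shrank).  KERNEL (PROVED). [folklore] -/
theorem deepCrossNewtShape_to_deepCrossShape {J : Ideal R} {c : Fin 4 → R} {q d : ℕ} (h : DeepCrossNewtShape J c q d) :
    DeepCrossShape J c q d := by
  obtain ⟨e₁, e₂, g, he₁, he₂, hg, hf, hJ⟩ := h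
  exact ⟨e₁, e₂, g, he₁, he₂, hg, hf, le_trans hJ (deepNewt_le_deepWt c q d)⟩

/-- The tail of a Newton-typed letter lies in the Newton member ideal (so `(f) + (tails) ⊆ deepNewt`: principal data
and data `(f) + tails`
satisfy the member bound automatically).  KERNEL (PROVED). [folklore] -/
theorem deepTail_le_deepNewt (c : Fin 4 → R) (q d : ℕ) :
    deepWt c q d (2 * (2 * q + 1) + 1) (2 * q + 1) (2 * (2 * q + 1) * d + 1) ≤ deepNewt c q d :=
  deepWt_le_deepNewt c q d _ _ _ (by omega) le_rfl (by omega)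

/-- **THE STEEP-PAIR WEIGHT** [g21] (`pairWt c m d λ₁ λ₃`, frame `c = (z, x, y, t)`, `(z,x,y)` the prime of the
steep branch, `t` inert):
monomials `zⁱ xᵃ yᵇ` with steep weight `m·i + 2(a+b) ≥ λ₁` and binomial-face weight `m·d·i + 2d·a + 2m·b ≥ λ₃`.
DEFINITION (NEW object). (Sources: Hironaka1967; CossartJannsenSaito2020 Ch. 8.) -/
def pairWt (c : Fin 4 → R) (m d l₁ l₃ : ℕ) : Ideal R :=
  Ideal.span {x | ∃ i a b : ℕ, l₁ ≤ m * i + 2 * (a + b) ∧ l₃ ≤ m * d * i + 2 * d * a + 2 * m * b ∧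
    x = c 0 ^ i * c 1 ^ a * c 2 ^ b}

/-- Monomials carrying both weights lie in the steep-pair ideal.  KERNEL (PROVED). [folklore] -/
theorem monomial_mem_pairWt (c : Fin 4 → R) (m d l₁ l₃ i a b : ℕ) (h₁ : l₁ ≤ m * i + 2 * (a + b))
    (h₃ : l₃ ≤ m * d * i + 2 * d * a + 2 * m * b) : c 0 ^ i * c 1 ^ a * c 2 ^ b ∈ pairWt c m d l₁ l₃ :=
  Ideal.subset_span ⟨i, a, b, h₁, h₃, rfl⟩

/-- **STEEP-PAIR SHAPE** [g21] (`SteepPairShape J c m d`), the letter at a closed point of the STEEP branch AWAY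
FROM THE FLAT ONE: a
member `f = z² + ε₁·x^m + ε₃·y^d + g ∈ J` (`ε₁, ε₃` units — along `C₁` the flat branch's `ε₂v²` has become the unit `ε₃`), tail
`g ∈ pairWt c m d (2m+1) (2md+1)`, members `J ⊆ pairWt c m d (2m) (2md)`.  The transversal section is the plane
binomial `x^m + ε y^d`
(the INSEP-vv7 points of `C₁ ∖ C₂`: `x⁵ + c²y⁷`).  DEFINITION (NEW class predicate, ring level). (Sources: Hironaka1967;
CossartJannsenSaito2020 Ch. 8; CossartPiltant2019 Def. 3.5.) -/
def SteepPairShape (J : Ideal R) (c : Fin 4 → R) (m d : ℕ) : Prop :=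
  ∃ e₁ e₃ g : R, IsUnit e₁ ∧ IsUnit e₃ ∧ g ∈ pairWt c m d (2 * m + 1) (2 * m * d + 1) ∧
    c 0 ^ 2 + e₁ * c 1 ^ m + e₃ * c 2 ^ d + g ∈ J ∧ J ≤ pairWt c m d (2 * m) (2 * m * d)

section DeepKernel

/-- **STAGE A OF THE GREEDY PACKAGE AT A DEEP TANGLE** [g21; KERNEL (PROVED): cumulative chart identity, `d = m +
r`]: in the `u₂`-branch of
the `q` steps of the steep tower (`z = Z·u^q`, `u₁ = w·u`, `u₂ = u`) the deep member becomes `u^{2q}·(Z² + u·(ε₁w^m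
+ ε₂v²u^r))` — at
`x_q` the flat branch carries the pinch `Z² + (ε₂u^{r+1})·v²` of inert depth `r + 1`: SUB-FLAT iff `r = 0` (g20),
STILL DEEP for `r ≥ 1`,
where the game continues (the `V`-chart of the next blow-up carries `Z′² + ε₂u^{r+1} + …`: a steep pair / top plane,
§Y.1 (X**)). [folklore] -/
theorem deep_towerOne (Z u w v e₁ e₂ : R) (q r : ℕ) :
    (Z * u ^ q) ^ 2 + e₁ * (w * u) ^ (2 * q + 1) + e₂ * v ^ 2 * u ^ (2 * q + 1 + r) =
      u ^ (2 * q) * (Z ^ 2 + u * (e₁ * w ^ (2 * q + 1) + e₂ * v ^ 2 * u ^ r)) := by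
  ring

/-- **THE `V`-CHART AFTER STAGE A** [g21; KERNEL (PROVED)]: blowing up the flat branch `V(Z, w, v)` at `x_q`,
`V`-chart (`Z = Z′·v`,
`w = w′·v`): `Z² + u(ε₁w^m + ε₂v²u^r) ↦ v²·(Z′² + ε₂u^{r+1} + ε₁u·w′^m·v^{m−2})` — for `r ≥ 1` the term `ε₂u^{r+1}`
is NOT linear: order `2`
along the plane / pair locus in the fibre (g20's sharpness remark, now the ENTRY of the deep game). [folklore] -/
theorem deep_vChart (Z' u w' v e₁ e₂ : R) (q r : ℕ) :
    (Z' * v) ^ 2 + u * (e₁ * (w' * v) ^ (2 * q + 1) + e₂ * v ^ 2 * u ^ r) =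
      v ^ 2 * (Z' ^ 2 + e₂ * u ^ (r + 1) + e₁ * u * w' ^ (2 * q + 1) * v ^ (2 * q - 1) * 1) ∨
    (Z' * v) ^ 2 + u * (e₁ * (w' * v) ^ (2 * q + 1) + e₂ * v ^ 2 * u ^ r) =
      v ^ 2 * (Z' ^ 2 + e₂ * u ^ (r + 1)) + u * e₁ * w' ^ (2 * q + 1) * v ^ (2 * q + 1) := by
  right
  ring

/-- INSEP-vv7, final chart 0 of the greedy package (coordinates `(E2, y, t)`; `x = E2`, `y = E2 * y`, `t = t`,
`μ = E2 ^ 2`): the total transform of `Z² + x⁵ + t²y⁷` is `μ² · (Z² + F_σ)` with `F_σ = E2 ^ 3 * y ^ 7 * t ^ 2 +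
E2`.  KERNEL (PROVED). [folklore] -/
theorem insepVV7_chart0 (Z E2 y t : R) :
    (Z * (E2 ^ 2)) ^ 2 + (E2) ^ 5 + (t) ^ 2 * (E2 * y) ^ 7 =
      (E2 ^ 2) ^ 2 * (Z ^ 2 + (E2 ^ 3 * y ^ 7 * t ^ 2 + E2)) := by
  ring

/-- INSEP-vv7, final chart 1 of the greedy package (coordinates `(E5, E2, t)`; `x = E5 ^ 3 * E2`, `y = E5 ^ 2 * E2`, `t = t`,
`μ = E5 ^ 7 * E2 ^ 2`): the total transform of `Z² + x⁵ + t²y⁷` is `μ² · (Z² + F_σ)` with `F_σ = E2 ^ 3 * t ^ 2 + E5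
* E2`.  KERNEL (PROVED). [folklore] -/
theorem insepVV7_chart1 (Z E5 E2 t : R) :
    (Z * (E5 ^ 7 * E2 ^ 2)) ^ 2 + (E5 ^ 3 * E2) ^ 5 + (t) ^ 2 * (E5 ^ 2 * E2) ^ 7 =
      (E5 ^ 7 * E2 ^ 2) ^ 2 * (Z ^ 2 + (E2 ^ 3 * t ^ 2 + E5 * E2)) := by
  ring

/-- INSEP-vv7, final chart 2 of the greedy package (coordinates `(E9, E5, t)`; `x = E9 ^ 2 * E5 ^ 3`, `y = E9 * E5 ^
2`, `t = E9 ^ 2 * t`,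
`μ = E9 ^ 5 * E5 ^ 7`): the total transform of `Z² + x⁵ + t²y⁷` is `μ² · (Z² + F_σ)` with `F_σ = E9 * t ^ 2 + E5`.
KERNEL (PROVED). [folklore] -/
theorem insepVV7_chart2 (Z E9 E5 t : R) :
    (Z * (E9 ^ 5 * E5 ^ 7)) ^ 2 + (E9 ^ 2 * E5 ^ 3) ^ 5 + (E9 ^ 2 * t) ^ 2 * (E9 * E5 ^ 2) ^ 7 =
      (E9 ^ 5 * E5 ^ 7) ^ 2 * (Z ^ 2 + (E9 * t ^ 2 + E5)) := by
  ring

/-- INSEP-vv7, final chart 3 of the greedy package (coordinates `(E6, E5, E9)`; `x = E6 ^ 2 * E5 ^ 3 * E9 ^ 2`, `y =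
E6 * E5 ^ 2 * E9`, `t = E6 * E9 ^ 2`,
`μ = E6 ^ 4 * E5 ^ 7 * E9 ^ 5`): the total transform of `Z² + x⁵ + t²y⁷` is `μ² · (Z² + F_σ)` with `F_σ = E6 ^ 2 *
E5 + E6 * E9`.  KERNEL (PROVED). [folklore] -/
theorem insepVV7_chart3 (Z E6 E5 E9 : R) :
    (Z * (E6 ^ 4 * E5 ^ 7 * E9 ^ 5)) ^ 2 + (E6 ^ 2 * E5 ^ 3 * E9 ^ 2) ^ 5 + (E6 * E9 ^ 2) ^ 2 * (E6 * E5 ^ 2 * E9) ^ 7 =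
      (E6 ^ 4 * E5 ^ 7 * E9 ^ 5) ^ 2 * (Z ^ 2 + (E6 ^ 2 * E5 + E6 * E9)) := by
  ring

/-- INSEP-vv7, final chart 4 of the greedy package (coordinates `(E3, E5, E6)`; `x = E3 ^ 2 * E5 ^ 3 * E6 ^ 2`, `y =
E3 * E5 ^ 2 * E6`, `t = E6`,
`μ = E3 ^ 3 * E5 ^ 7 * E6 ^ 4`): the total transform of `Z² + x⁵ + t²y⁷` is `μ² · (Z² + F_σ)` with `F_σ = E3 ^ 4 *
E5 * E6 ^ 2 + E3 * E6`.  KERNEL (PROVED). [folklore] -/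
theorem insepVV7_chart4 (Z E3 E5 E6 : R) :
    (Z * (E3 ^ 3 * E5 ^ 7 * E6 ^ 4)) ^ 2 + (E3 ^ 2 * E5 ^ 3 * E6 ^ 2) ^ 5 + (E6) ^ 2 * (E3 * E5 ^ 2 * E6) ^ 7 =
      (E3 ^ 3 * E5 ^ 7 * E6 ^ 4) ^ 2 * (Z ^ 2 + (E3 ^ 4 * E5 * E6 ^ 2 + E3 * E6)) := by
  ring

/-- INSEP-vv7, final chart 5 of the greedy package (coordinates `(E8, E9, t)`; `x = E8 * E9 ^ 2`, `y = E9`, `t = E8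
^ 2 * E9 ^ 2 * t`,
`μ = E8 ^ 2 * E9 ^ 5`): the total transform of `Z² + x⁵ + t²y⁷` is `μ² · (Z² + F_σ)` with `F_σ = E9 * t ^ 2 + E8`.
KERNEL (PROVED). [folklore] -/
theorem insepVV7_chart5 (Z E8 E9 t : R) :
    (Z * (E8 ^ 2 * E9 ^ 5)) ^ 2 + (E8 * E9 ^ 2) ^ 5 + (E8 ^ 2 * E9 ^ 2 * t) ^ 2 * (E9) ^ 7 =
      (E8 ^ 2 * E9 ^ 5) ^ 2 * (Z ^ 2 + (E9 * t ^ 2 + E8)) := by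
  ring

/-- INSEP-vv7, final chart 6 of the greedy package (coordinates `(E8, E6, E9)`; `x = E8 * E6 ^ 2 * E9 ^ 2`, `y = E6
* E9`, `t = E8 ^ 2 * E6 * E9 ^ 2`,
`μ = E8 ^ 2 * E6 ^ 4 * E9 ^ 5`): the total transform of `Z² + x⁵ + t²y⁷` is `μ² · (Z² + F_σ)` with `F_σ = E8 * E6 ^
2 + E6 * E9`.  KERNEL (PROVED). [folklore] -/
theorem insepVV7_chart6 (Z E8 E6 E9 : R) :
    (Z * (E8 ^ 2 * E6 ^ 4 * E9 ^ 5)) ^ 2 + (E8 * E6 ^ 2 * E9 ^ 2) ^ 5 + (E8 ^ 2 * E6 * E9 ^ 2) ^ 2 * (E6 * E9) ^ 7 =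
      (E8 ^ 2 * E6 ^ 4 * E9 ^ 5) ^ 2 * (Z ^ 2 + (E8 * E6 ^ 2 + E6 * E9)) := by
  ring

end DeepKernel

end DeepRing

end Summit.ResolutionOfSingularities.ResolutionOfSingularities.Theorems.DeepCrossCut
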